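/- Free-seat work of WIDTH SEAT `ym-line-cbag-p1-w2` (prover-ym-line-cbag-p1-w2-g18-0), route `EguchiKawaiDirectionLadder`
(ideator ym-idea-2, LINE 8), crux `TripleSmallBallMargin` (stmt-QuantumFields-27724), v7 last mile, step (1) of the LEAD's
FILE A: from the CENTRE-SYMMETRY GUARD `‖(Σ_j e^{iθ_j})/N‖² ≤ δ` of an eigenangle configuration to the block labelling of the
unit family `d_j = e^{iθ_j}` with `γ`-separated blocks, a collar of size `≤ N/M`, and at least `((N − N/M)² − ((1+δ)/2 + ε)N²)/2`
increasing labelled cross pairs — the planner's `centreSymmetricProfile_proof` (pair mass `≤ (1+δ)/2 + ε`) chained with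
`BlockRelabel.blocks_from_pair_profile_fin`.  Pure bookkeeping, ROUTE-INDEPENDENT.  The route bears on the barrier-ledger fact
`EguchiKawaiBreakdown`; the Yang–Mills mass gap is NOT proved by anything here. -/
import Summits.QuantumFields.YangMills.Theorems.EguchiKawaiDirectionLadderFirstLinkWeylReduction
import Summits.QuantumFields.YangMills.Theorems.EguchiKawaiDirectionLadderBlockRelabel
import HarnessLib

/-!
# Route `EguchiKawaiDirectionLadder`, crux `TripleSmallBallMargin`: block labels of a centre-symmetric eigenangle configuration

With `d_j = e^{iθ_j}` and `X'(ℓ) = #{(j,k) : j < k, ℓ j ≠ ℓ k, ℓ j ≠ last, ℓ k ≠ last}`: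

* `card_filter_prod_eq_sum_card_filter` — `#{(j,k) : P j k} = Σ_j #{k : P j k}` (product count versus iterated count);
* `closePairs_le_of_centreSymmetric` — for `0 < δ ≤ 1/2`, `0 < ε` there is `r > 0` such that for every `N > 0` and every `θ` with
  `‖(Σ_j e^{iθ_j})/N‖² ≤ δ` the ORDERED `r`-close pairs number at most `((1+δ)/2 + ε)·N²` (`centreSymmetricProfile_proof` read through
  `pairMass_diagPhases`);
* `centreSymmetric_blocks` — for `0 < δ ≤ 1/2`, `0 < ε`, `M ≥ 2` there are `m`, `γ > 0`, `r > 0` such that every such `θ` (any `N > 0`)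
  admits `ℓ : Fin N → Fin (m+1)` with (i) `γ ≤ |d_j − d_k|²` across distinct non-collar labels, (ii) `|d_j − d_k| ≤ r` inside each block,
  (iii) `#{ℓ = last} ≤ N/M`, (iv) `((N − N/M)² − ((1+δ)/2 + ε)N²)/2 ≤ X'(ℓ)`.
-/

set_option autoImplicit false

noncomputable section

open Finset MeasureTheory
open Literature.Barriers.QuantumFields
open Literature.LinearAlgebra.Matrix (diagonalTorusHom)

namespace Summit.QuantumFields.YangMills.Theorems.EguchiKawaiDirectionLadder

variable {N : ℕ}

/-- Product count versus iterated count: `#{(j,k) : P j k} = Σ_j #{k : P j k}`. -/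
theorem card_filter_prod_eq_sum_card_filter (P : Fin N → Fin N → Prop) [∀ j k, Decidable (P j k)] :
    ((univ : Finset (Fin N × Fin N)).filter fun p => P p.1 p.2).card = ∑ j : Fin N, (univ.filter fun k => P j k).card := by
  rw [card_filter, ← univ_product_univ, sum_product]
  refine sum_congr rfl fun j _ => ?_
  rw [card_filter]

/-- **Close pairs under the centre-symmetry guard.**  For `0 < δ ≤ 1/2` and `0 < ε` there is `r > 0` such that for every
`N > 0` and every eigenangle configuration `θ` with `‖(Σ_j e^{iθ_j})/N‖² ≤ δ`, the ordered pairs `(j,k)` with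
`|e^{iθ_j} − e^{iθ_k}| ≤ r` number at most `((1+δ)/2 + ε)·N²`. -/
theorem closePairs_le_of_centreSymmetric (δ ε : ℝ) (hδ : 0 < δ) (hδ2 : δ ≤ 1 / 2) (hε : 0 < ε) :
    ∃ r : ℝ, 0 < r ∧ ∀ N : ℕ, 0 < N → ∀ θ : Fin N → ℝ,
      ‖(∑ j : Fin N, Complex.exp (θ j * Complex.I)) / (N : ℂ)‖ ^ 2 ≤ δ →
        (((univ : Finset (Fin N × Fin N)).filter fun p =>
            ‖Complex.exp (θ p.1 * Complex.I) - Complex.exp (θ p.2 * Complex.I)‖ ≤ r).card : ℝ) ≤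
          ((1 + δ) / 2 + ε) * (N : ℝ) ^ 2 := by
  obtain ⟨r, hr, h⟩ := centreSymmetricProfile_proof δ ε hδ hδ2 hε
  refine ⟨r, hr, fun N hN θ hθ => ?_⟩
  have hθ' : ‖Matrix.trace ((diagonalTorusHom (Fin N) fun j => Circle.exp (θ j) : UN N) : Matrix (Fin N) (Fin N) ℂ) /
      (N : ℂ)‖ ^ 2 ≤ δ := by rwa [trace_diagPhases]
  have hpm := h N hN _ hθ'
  rw [pairMass_diagPhases, div_le_iff₀ (by positivity)] at hpm
  have hcount : ((univ : Finset (Fin N × Fin N)).filter fun p =>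
        ‖Complex.exp (θ p.1 * Complex.I) - Complex.exp (θ p.2 * Complex.I)‖ ≤ r).card =
      ∑ j : Fin N, (univ.filter fun k => ‖Complex.exp (θ j * Complex.I) - Complex.exp (θ k * Complex.I)‖ ≤ r).card :=
    card_filter_prod_eq_sum_card_filter
      (fun j k => ‖Complex.exp (θ j * Complex.I) - Complex.exp (θ k * Complex.I)‖ ≤ r)
  rw [hcount]
  push_cast
  exact hpm

/-- **Block labels of a centre-symmetric eigenangle configuration.**  For `0 < δ ≤ 1/2`, `0 < ε` and `M ≥ 2` there are `m`,
`γ > 0` and `r > 0` such that for every `N > 0` and every `θ : Fin N → ℝ` with `‖(Σ_j e^{iθ_j})/N‖² ≤ δ` there is a labelling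
`ℓ : Fin N → Fin (m+1)` (collar label `Fin.last m`) of `d_j = e^{iθ_j}` with (i) `γ ≤ |d_j − d_k|²` whenever `ℓ j ≠ ℓ k` are both
non-collar, (ii) `|d_j − d_k| ≤ r` inside each block, (iii) `#{ℓ = last} ≤ N/M`, and (iv)
`((N − N/M)² − ((1+δ)/2 + ε)·N²)/2 ≤ X'(ℓ)` increasing labelled cross pairs. -/
theorem centreSymmetric_blocks (δ ε : ℝ) (hδ : 0 < δ) (hδ2 : δ ≤ 1 / 2) (hε : 0 < ε) (M : ℕ) (hM : 2 ≤ M) :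
    ∃ m : ℕ, ∃ γ : ℝ, 0 < γ ∧ ∃ r : ℝ, 0 < r ∧ ∀ N : ℕ, 0 < N → ∀ θ : Fin N → ℝ,
      ‖(∑ j : Fin N, Complex.exp (θ j * Complex.I)) / (N : ℂ)‖ ^ 2 ≤ δ →
        ∃ ℓ : Fin N → Fin (m + 1),
          (∀ j k, ℓ j ≠ ℓ k → ℓ j ≠ Fin.last m → ℓ k ≠ Fin.last m →
              γ ≤ ‖Complex.exp (θ j * Complex.I) - Complex.exp (θ k * Complex.I)‖ ^ 2) ∧
          (∀ j k (c : Fin m), ℓ j = Fin.castSucc c → ℓ k = Fin.castSucc c →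
              ‖Complex.exp (θ j * Complex.I) - Complex.exp (θ k * Complex.I)‖ ≤ r) ∧
          ((univ.filter fun i => ℓ i = Fin.last m).card : ℝ) ≤ N / M ∧
          (((N : ℝ) - N / M) ^ 2 - ((1 + δ) / 2 + ε) * (N : ℝ) ^ 2) / 2 ≤
            (((univ : Finset (Fin N × Fin N)).filter
              (fun p => p.1 < p.2 ∧ ℓ p.1 ≠ ℓ p.2 ∧ ℓ p.1 ≠ Fin.last m ∧ ℓ p.2 ≠ Fin.last m)).card : ℝ) := by
  obtain ⟨r, hr, hclose⟩ := closePairs_le_of_centreSymmetric δ ε hδ hδ2 hε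
  obtain ⟨m, γ, hγ, hblocks⟩ := BlockRelabel.blocks_from_pair_profile_fin r hr M hM
  refine ⟨m, γ, hγ, r, hr, fun N hN θ hθ => ?_⟩
  obtain ⟨ℓ, hsep, hcl, hcollar, hX⟩ := hblocks N (fun j => Complex.exp (θ j * Complex.I)) fun j => Complex.norm_exp_ofReal_mul_I (θ j)
  refine ⟨ℓ, hsep, hcl, hcollar, ?_⟩
  have hc := hclose N hN θ hθ
  linarith

end Summit.QuantumFields.YangMills.Theorems.EguchiKawaiDirectionLadder

end
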